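import Summits.MatrixMultiplication.MatrixMultiplication.Theorems.SaturationLadderSubThreeSaturation
import Summits.MatrixMultiplication.MatrixMultiplication.Theorems.SaturationLadderTwinRung
import HarnessLib

/-!
# SaturationLadder — the crux `SubexpSaturation` IS a graded conjunction (the base family)

Route `SaturationLadder` (sub-problem `MatrixMultiplication`), crux item `SubexpSaturation`
(stmt-MatrixMultiplication-25909, rank 2):

  `∀ c > 0, ∃ t₀ < 1, ∀ t ∈ [t₀, 1), ∃ r, 1 ≤ r ≤ e^{c/(1−t)} ∧ ω(1, t, r) ≤ 1 + r`.

The cell's base ladder (cell `decomp-mm`, lens 1 «grading / quantitative ladder») grades this crux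
by the ONE-PARAMETER FAMILY

  `Base(θ) :≡ ∃ C, ∀ t ∈ [0,1), ∃ r, 1 ≤ r ≤ C · θ^{1/(1−t)} ∧ ω(1, t, r) ≤ 1 + r`   (`θ` a real base),

written out verbatim below (no new definition is introduced: a proposition-valued `def` under
`Summits/` would be an unregistered obligation).  This support file (gen 10) proves that the crux is
LITERALLY the graded conjunction of the family over all bases above `1`, and that the family is
monotone, so the state of the ladder is one number — the infimum of the proved bases:

* `subexpSaturation_iff_forall_base` : `SubexpSaturation ↔ ∀ θ > 1, Base(θ)`
  (`→`: take `c = log θ`; the small `t` are covered by the landed Coppersmith–Winograd rung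
  `expSaturation_holds`, item 25913; `←`: take the grade `θ = e^{c/2}` and absorb its constant `C`
  into the other half of the exponent);
* `subexpSaturation_iff_base_seq` : equivalently `Base(1 + 1/(n+1))` for every `n : ℕ`;
* `base_mono` : `0 ≤ θ ≤ θ'` and `Base(θ)` give `Base(θ')`;
* the proved grades, by their landed names: `Base(4)` with `C = 16` is
  `SaturationLadderTwinRung.expSaturation_shape` (item 25913 `expSaturation_holds`); `Base(3)` is the
  item `TwinSaturation` verbatim (stmt-MatrixMultiplication-30539, `twinSaturation`); `Base(297/100)` is
  `SaturationLadderSubThreeSaturation.saturationBase_297` (the proof of the sub-three rung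
  `SubThreeSaturation`, stmt-MatrixMultiplication-32679, which is `∃ θ ∈ (0,3), Base(θ)` verbatim);
  hence **`base_of_ge_297` : every base `θ ≥ 2.97` is a theorem** — the exact grade where the
  theorems of the ladder currently stop; every later rung is an instance `Base(θ₀)`, `θ₀ < 2.97`.

No named facts, no sorry, no definitions.
-/

set_option linter.dupNamespace false
-- (single-conjunct summit: the namespace repeats `MatrixMultiplication`)

noncomputable section

namespace Summit.MatrixMultiplication.MatrixMultiplication.Theorems.SaturationLadderBaseFamily

open Literature.Computability.AlgebraicComplexity
open Summit.MatrixMultiplication.MatrixMultiplication.Theses.SaturationLadder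
  (SubexpSaturation TwinSaturation SubThreeSaturation)
open Summit.MatrixMultiplication.MatrixMultiplication.Theorems.SaturationLadderExpSaturation
  (expSaturation_holds)
open Summit.MatrixMultiplication.MatrixMultiplication.Theorems.SaturationLadderTwinSaturation
  (twinSaturation)
open Summit.MatrixMultiplication.MatrixMultiplication.Theorems.SaturationLadderSubThreeSaturation
  (saturationBase_297)

/-! ## Monotonicity of the family and the proved grades -/

/-- The base family is upward closed: `0 ≤ θ ≤ θ'` and `Base(θ)` give `Base(θ')` (the constant is
replaced by `max C 0`). [folklore] -/
theorem base_mono {θ θ' : ℝ} (hθ : 0 ≤ θ) (hle : θ ≤ θ')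
    (h : ∃ C : ℝ, ∀ t : ℝ, 0 ≤ t → t < 1 →
      ∃ r : ℝ, 1 ≤ r ∧ r ≤ C * θ ^ (1 / (1 - t)) ∧ omegaRect ℂ 1 t r ≤ 1 + r) :
    ∃ C : ℝ, ∀ t : ℝ, 0 ≤ t → t < 1 →
      ∃ r : ℝ, 1 ≤ r ∧ r ≤ C * θ' ^ (1 / (1 - t)) ∧ omegaRect ℂ 1 t r ≤ 1 + r := by
  obtain ⟨C, hC⟩ := h
  refine ⟨max C 0, fun t ht0 ht1 => ?_⟩
  obtain ⟨r, hr1, hrC, hcert⟩ := hC t ht0 ht1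
  refine ⟨r, hr1, ?_, hcert⟩
  have hx : 0 ≤ 1 / (1 - t) := by
    have : 0 < 1 - t := by linarith
    positivity
  have h1 : θ ^ (1 / (1 - t)) ≤ θ' ^ (1 / (1 - t)) := Real.rpow_le_rpow hθ hle hx
  have h2 : 0 ≤ θ ^ (1 / (1 - t)) := Real.rpow_nonneg hθ _
  calc r ≤ C * θ ^ (1 / (1 - t)) := hrC
    _ ≤ max C 0 * θ ^ (1 / (1 - t)) := mul_le_mul_of_nonneg_right (le_max_left _ _) h2
    _ ≤ max C 0 * θ' ^ (1 / (1 - t)) := mul_le_mul_of_nonneg_left h1 (le_max_right _ _)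

/-- Every grade `θ ≥ 3` follows from the twin rung `twinSaturation` (item 30539, `Base(3)` verbatim)
by monotonicity; `Base(4)` with `C = 16` is `SaturationLadderTwinRung.expSaturation_shape`. [folklore] -/
theorem base_of_three_le {θ : ℝ} (hθ : 3 ≤ θ) : ∃ C : ℝ, ∀ t : ℝ, 0 ≤ t → t < 1 →
    ∃ r : ℝ, 1 ≤ r ∧ r ≤ C * θ ^ (1 / (1 - t)) ∧ omegaRect ℂ 1 t r ≤ 1 + r :=
  base_mono (by norm_num) hθ twinSaturation

/-- **The current frontier of the base ladder: every grade `θ ≥ 2.97` is a theorem** (from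
`saturationBase_297`, the base of the landed proof of the sub-three rung, item 32679). [folklore] -/
theorem base_of_ge_297 {θ : ℝ} (hθ : 297 / 100 ≤ θ) : ∃ C : ℝ, ∀ t : ℝ, 0 ≤ t → t < 1 →
    ∃ r : ℝ, 1 ≤ r ∧ r ≤ C * θ ^ (1 / (1 - t)) ∧ omegaRect ℂ 1 t r ≤ 1 + r :=
  base_mono (by norm_num) hθ saturationBase_297

/-- The sub-three rung in family form: `SubThreeSaturation` (item stmt-MatrixMultiplication-32679)
yields a base `θ < 3` such that every grade `θ' ≥ θ` holds (monotonicity). [folklore] -/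
theorem grades_of_subThree (h : SubThreeSaturation) :
    ∃ θ : ℝ, 0 < θ ∧ θ < 3 ∧ ∀ θ' : ℝ, θ ≤ θ' → ∃ C : ℝ, ∀ t : ℝ, 0 ≤ t → t < 1 →
      ∃ r : ℝ, 1 ≤ r ∧ r ≤ C * θ' ^ (1 / (1 - t)) ∧ omegaRect ℂ 1 t r ≤ 1 + r := by
  obtain ⟨θ, hθ0, hθ3, hbase⟩ := h
  exact ⟨θ, hθ0, hθ3, fun θ' hle => base_mono hθ0.le hle hbase⟩

/-- For `t ∈ [0, t₁]` the CW rung bounds the saturation abscissa by the CONSTANT `16 · 4^{1/(1−t₁)}`.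
[folklore] -/
theorem abscissa_le_const_of_le {t t₁ : ℝ} (ht0 : 0 ≤ t) (ht : t ≤ t₁) (ht₁ : t₁ < 1) :
    ∃ r : ℝ, 1 ≤ r ∧ r ≤ 16 * (4 : ℝ) ^ (1 / (1 - t₁)) ∧ omegaRect ℂ 1 t r ≤ 1 + r := by
  obtain ⟨r, hr1, hrC, hcert⟩ := expSaturation_holds t ht0 (lt_of_le_of_lt ht ht₁)
  refine ⟨r, hr1, hrC.trans ?_, hcert⟩
  have h1t : 0 < 1 - t₁ := by linarith
  have hexp : 1 / (1 - t) ≤ 1 / (1 - t₁) :=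
    one_div_le_one_div_of_le h1t (by linarith)
  have h4 : (4 : ℝ) ^ (1 / (1 - t)) ≤ (4 : ℝ) ^ (1 / (1 - t₁)) :=
    Real.rpow_le_rpow_of_exponent_le (by norm_num) hexp
  linarith

/-! ## The crux is the graded conjunction -/

/-- `θ^{1/(1−t)} = e^{log θ /(1−t)}` for `θ > 0`. [folklore] -/
theorem rpow_inv_eq_exp {θ t : ℝ} (hθ : 0 < θ) :
    θ ^ (1 / (1 - t)) = Real.exp (Real.log θ / (1 - t)) := by
  rw [Real.rpow_def_of_pos hθ]
  congr 1
  ring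

/-- **`SubexpSaturation → Base(θ)` for every `θ > 1`.**  With `c = log θ > 0` the crux gives the
bound `θ^{1/(1−t)}` on `[t₀, 1)`; below `max t₀ 0` the CW rung gives a constant, and
`θ^{1/(1−t)} ≥ 1`. [folklore] -/
theorem base_of_subexpSaturation (h : SubexpSaturation) {θ : ℝ} (hθ : 1 < θ) :
    ∃ C : ℝ, ∀ t : ℝ, 0 ≤ t → t < 1 →
      ∃ r : ℝ, 1 ≤ r ∧ r ≤ C * θ ^ (1 / (1 - t)) ∧ omegaRect ℂ 1 t r ≤ 1 + r := by
  have hθ0 : 0 < θ := by linarith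
  have hc : 0 < Real.log θ := Real.log_pos hθ
  obtain ⟨t₀, ht₀1, ht₀⟩ := h (Real.log θ) hc
  set t₁ : ℝ := max t₀ 0 with ht₁_def
  have ht₁1 : t₁ < 1 := max_lt ht₀1 one_pos
  set C : ℝ := max (16 * (4 : ℝ) ^ (1 / (1 - t₁))) 1 with hC_def
  have hC1 : 1 ≤ C := le_max_right _ _
  have hC0 : 0 ≤ C := le_trans zero_le_one hC1
  refine ⟨C, fun t ht0 ht1 => ?_⟩
  have hpow1 : 1 ≤ θ ^ (1 / (1 - t)) := by
    have : 0 < 1 - t := by linarith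
    exact Real.one_le_rpow hθ.le (by positivity)
  rcases le_or_gt t₁ t with hle | hlt
  · -- `t ≥ t₁ ≥ t₀`: the crux's own bound
    have ht₀t : t₀ ≤ t := le_trans (le_max_left _ _) hle
    obtain ⟨r, hr1, hr, hcert⟩ := ht₀ t ht₀t ht1
    refine ⟨r, hr1, ?_, hcert⟩
    rw [← rpow_inv_eq_exp hθ0] at hr
    calc r ≤ θ ^ (1 / (1 - t)) := hr
      _ = 1 * θ ^ (1 / (1 - t)) := (one_mul _).symm
      _ ≤ C * θ ^ (1 / (1 - t)) :=
          mul_le_mul_of_nonneg_right hC1 (le_trans zero_le_one hpow1)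
  · -- `t < t₁`: the CW rung gives a constant
    obtain ⟨r, hr1, hr, hcert⟩ := abscissa_le_const_of_le ht0 hlt.le ht₁1
    refine ⟨r, hr1, ?_, hcert⟩
    calc r ≤ 16 * (4 : ℝ) ^ (1 / (1 - t₁)) := hr
      _ ≤ C := le_max_left _ _
      _ = C * 1 := (mul_one _).symm
      _ ≤ C * θ ^ (1 / (1 - t)) := mul_le_mul_of_nonneg_left hpow1 hC0

/-- **`(∀ θ > 1, Base(θ))` gives the clause of the crux at every rate `c > 0`** (the conclusion is the
body of `SubexpSaturation`, verbatim).  Use the grade `θ = e^{c/2}`: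
`C · e^{c/(2(1−t))} ≤ e^{c/(1−t)}` as soon as `log C ≤ c/(2(1−t))`. [folklore] -/
theorem subexp_clause_of_forall_base
    (h : ∀ θ : ℝ, 1 < θ → ∃ C : ℝ, ∀ t : ℝ, 0 ≤ t → t < 1 →
      ∃ r : ℝ, 1 ≤ r ∧ r ≤ C * θ ^ (1 / (1 - t)) ∧ omegaRect ℂ 1 t r ≤ 1 + r)
    (c : ℝ) (hc : 0 < c) :
    ∃ t₀ : ℝ, t₀ < 1 ∧ ∀ t : ℝ, t₀ ≤ t → t < 1 →
      ∃ r : ℝ, 1 ≤ r ∧ r ≤ Real.exp (c / (1 - t)) ∧ omegaRect ℂ 1 t r ≤ 1 + r := by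
  have hθ : 1 < Real.exp (c / 2) := by
    rw [← Real.exp_zero]; exact Real.exp_lt_exp.mpr (by positivity)
  obtain ⟨C, hC⟩ := h _ hθ
  set M : ℝ := max (Real.log C) 1 with hM_def
  have hM1 : 1 ≤ M := le_max_right _ _
  have hM0 : 0 < M := lt_of_lt_of_le one_pos hM1
  set t₀ : ℝ := max 0 (1 - c / (2 * M)) with ht₀_def
  have hcm : 0 < c / (2 * M) := by positivity
  have ht₀1 : t₀ < 1 := max_lt one_pos (by linarith)
  refine ⟨t₀, ht₀1, fun t ht₀t ht1 => ?_⟩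
  have ht0 : 0 ≤ t := le_trans (le_max_left _ _) ht₀t
  have h1t : 0 < 1 - t := by linarith
  obtain ⟨r, hr1, hr, hcert⟩ := hC t ht0 ht1
  refine ⟨r, hr1, hr.trans ?_, hcert⟩
  -- the grade's growth: `(e^{c/2})^{1/(1−t)} = e^{(c/2)/(1−t)}`
  have hgrow : Real.exp (c / 2) ^ (1 / (1 - t)) = Real.exp (c / 2 / (1 - t)) := by
    rw [rpow_inv_eq_exp (Real.exp_pos _), Real.log_exp]
  have hsplit : Real.exp (c / (1 - t)) =
      Real.exp (c / 2 / (1 - t)) * Real.exp (c / 2 / (1 - t)) := by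
    rw [← Real.exp_add]; congr 1; field_simp; ring
  rw [hgrow, hsplit]
  refine mul_le_mul_of_nonneg_right ?_ (Real.exp_pos _).le
  -- `C ≤ e^{c/(2(1−t))}`
  rcases le_or_gt C 1 with hC1 | hC1
  · exact hC1.trans (Real.one_le_exp (by positivity))
  · have hlogC : Real.log C ≤ M := le_max_left _ _
    have hge : 1 - c / (2 * M) ≤ t := le_trans (le_max_right _ _) ht₀t
    have h1t_le : 1 - t ≤ c / (2 * M) := by linarith
    have hM_le : M ≤ c / 2 / (1 - t) := by
      rw [le_div_iff₀ h1t]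
      calc M * (1 - t) ≤ M * (c / (2 * M)) := mul_le_mul_of_nonneg_left h1t_le hM0.le
        _ = c / 2 := by field_simp
    calc C = Real.exp (Real.log C) := (Real.exp_log (by linarith)).symm
      _ ≤ Real.exp (c / 2 / (1 - t)) := Real.exp_le_exp.mpr (hlogC.trans hM_le)

/-- **The crux `SubexpSaturation` is the graded conjunction of the base family over all bases
`θ > 1`.**  Proved grades: `θ = 4` (`expSaturation_shape`, item 25913), `θ = 3` (`twinSaturation`,
item 30539), `θ = 2.97` (`saturationBase_297`, item 32679) and everything above (`base_of_ge_297`).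
[folklore] -/
theorem subexpSaturation_iff_forall_base :
    SubexpSaturation ↔ ∀ θ : ℝ, 1 < θ → ∃ C : ℝ, ∀ t : ℝ, 0 ≤ t → t < 1 →
      ∃ r : ℝ, 1 ≤ r ∧ r ≤ C * θ ^ (1 / (1 - t)) ∧ omegaRect ℂ 1 t r ≤ 1 + r :=
  ⟨fun h _ hθ => base_of_subexpSaturation h hθ, fun h c hc => subexp_clause_of_forall_base h c hc⟩

/-- Equivalently, by monotonicity: the crux holds iff the grades hold along the bases `1 + 1/(n+1)`,
`n : ℕ` (any sequence of bases decreasing to `1` would do). [folklore] -/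
theorem subexpSaturation_iff_base_seq :
    SubexpSaturation ↔ ∀ n : ℕ, ∃ C : ℝ, ∀ t : ℝ, 0 ≤ t → t < 1 →
      ∃ r : ℝ, 1 ≤ r ∧ r ≤ C * (1 + 1 / ((n : ℝ) + 1)) ^ (1 / (1 - t)) ∧
        omegaRect ℂ 1 t r ≤ 1 + r := by
  rw [subexpSaturation_iff_forall_base]
  constructor
  · intro h n
    have hn : (0 : ℝ) < 1 / ((n : ℝ) + 1) := by positivity
    exact h _ (by linarith)
  · intro h θ hθ
    -- pick `n` with `1/(n+1) < θ − 1`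
    obtain ⟨n, hn⟩ := exists_nat_one_div_lt (by linarith : 0 < θ - 1)
    exact base_mono (by positivity) (by linarith [hn.le]) (h n)

end Summit.MatrixMultiplication.MatrixMultiplication.Theorems.SaturationLadderBaseFamily

end
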